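import Literature.MathematicalPhysics.QuantumManyBody.PeriodicBoseGasBogoliubov
import Literature.MathematicalPhysics.QuantumManyBody.PeriodicBoseGasFourierL2
import HarnessLib

/-!
# Fournais 2020, (2.32): `∫‖b_pΦ‖² dp ≤ ‖χ‖²_∞ n ℓ⁻³ ⟨Φ, n₊Φ⟩` (Plancherel slice-wise)

Topic `Literature/MathematicalPhysics/QuantumManyBody` (provefact
`Literature.MathematicalPhysics.QuantumManyBody.BoseGas.Fournais2020_condensation`, layer `Fournais2020_lemma24`).
In the proof of [Fournais2020, Lemma 2.4] the term `2Ŵ₁(0)` added to the kinetic multiplier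
(2.31) is paid for by "`½(2π)⁻³∫2Ŵ₁(0)(b_p†b_p + b_{-p}†b_{-p})dp ≤ Ca(n₀+1)n₊/ℓ³`" (2.32). With the
first-quantised `b_pΦ = ℓ⁻³∑ᵢ𝓕(χ_ΛQᵢΦ(X;·ᵢ))(p)` of `PeriodicBoseGasBogoliubov.lean` this is
Cauchy–Schwarz in the particle sum followed by Plancherel on each slice:

* `lintegral_normSq_excAmp_le`: `∫|𝓕(χ_ΛQᵢΦ(X;·))(p)|²dp ≤ ‖χ‖²_∞ ∫|Q_uΦ(X;·)|²` for every `X`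
  (the unconditional inequality `∫|𝓕h|² ≤ ∫|h|²`, `PeriodicBoseGasFourierL2.lean`);
* `lintegral_lintegral_normSq_bVec_le`: **`∫ ‖b_pΦ‖²_{L²(Λⁿ)} dp ≤ ‖χ‖²_∞ · n ℓ⁻³ · nPlusBoxN`**
  (`nPlusBoxN = ⟨Φ,n₊Φ⟩ = ∑ᵢ ℓ⁻³∫_{Λⁿ}∫|Q_uΦ(X;·ᵢ)|²`), i.e. (2.32) with `n` in place of `n₀ + 1`
  once multiplied by `2Ŵ₁(0) ≤ C a` (`PeriodicBoseGasBigW1Sharp.lean`).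

## References

* [Fournais2020] S. Fournais, *Length scales for BEC in the dilute Bose gas*, arXiv:2011.00309,
  EMS Ser. Congr. Rep. 18 (2021), doi:10.4171/ecr/18-1/7: Lemma 2.4, (2.27), (2.31)–(2.32).
-/

noncomputable section

open MeasureTheory Set
open scoped ENNReal NNReal FourierTransform

namespace Literature.MathematicalPhysics.QuantumManyBody.BoseGas

variable {n : ℕ}

/-- `|χ_Λ(y) (QΦ(X;·))(y)| ≤ ‖χ‖_∞ |(QΦ(X;·))(y)|`. [cite: Fournais2020, (2.27)] -/
theorem nnnorm_sliceExc_sq_le {χ : Space → ℝ} {Cχ : ℝ} (hCχ : ∀ x, ‖χ x‖ ≤ Cχ) (ℓ : ℝ) (u : Space)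
    (i : Fin n) (Φ : Config n → ℂ) (X : Config n) (y : Space) :
    ((‖sliceExc χ ℓ u i Φ X y‖₊ : ℝ≥0∞)) ^ 2 ≤
      ENNReal.ofReal (Cχ ^ 2) * ((‖projQ ℓ u (fun z => Φ (Function.update X i z)) y‖₊ : ℝ≥0∞)) ^ 2 := by
  have hC0 : 0 ≤ Cχ := (norm_nonneg _).trans (hCχ 0)
  rw [sliceExc, nnnorm_mul, ENNReal.coe_mul, mul_pow]
  refine mul_le_mul_left ?_ _
  rw [← ENNReal.coe_pow, ← ENNReal.ofReal_coe_nnreal, NNReal.coe_pow, coe_nnnorm, Complex.norm_real]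
  exact ENNReal.ofReal_le_ofReal (pow_le_pow_left₀ (norm_nonneg _) (hCχ _) 2)

/-- **Plancherel on a slice**: `∫|𝓕(χ_ΛQᵢΦ(X;·))(p)|²dp ≤ ‖χ‖²_∞ ∫|Q_uΦ(X;·)|²dy`.
[cite: Fournais2020, (2.27), (2.32)] -/
theorem lintegral_normSq_excAmp_le {χ : Space → ℝ} (hχ : Continuous χ) {Cχ : ℝ} (hCχ : ∀ x, ‖χ x‖ ≤ Cχ)
    (ℓ : ℝ) (u : Space) (i : Fin n) {Φ : Config n → ℂ} (hΦ : Measurable Φ) (X : Config n) :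
    ∫⁻ p : Space, ((‖excAmp χ ℓ u i Φ X p‖₊ : ℝ≥0∞)) ^ 2 ≤
      ENNReal.ofReal (Cχ ^ 2) * ∫⁻ y, ((‖projQ ℓ u (fun z => Φ (Function.update X i z)) y‖₊ : ℝ≥0∞)) ^ 2 := by
  have hm : AEStronglyMeasurable (sliceExc χ ℓ u i Φ X) volume :=
    ((measurable_sliceExc hχ ℓ u i hΦ).comp (measurable_prodMk_left (x := X))).aestronglyMeasurable
  calc ∫⁻ p : Space, ((‖excAmp χ ℓ u i Φ X p‖₊ : ℝ≥0∞)) ^ 2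
      ≤ ∫⁻ y, ((‖sliceExc χ ℓ u i Φ X y‖₊ : ℝ≥0∞)) ^ 2 := lintegral_nnnorm_sq_fourier_le _ hm
    _ ≤ ∫⁻ y, ENNReal.ofReal (Cχ ^ 2) * ((‖projQ ℓ u (fun z => Φ (Function.update X i z)) y‖₊ : ℝ≥0∞)) ^ 2 :=
        lintegral_mono fun y => nnnorm_sliceExc_sq_le hCχ ℓ u i Φ X y
    _ = _ := lintegral_const_mul' _ _ ENNReal.ofReal_ne_top

/-- **Fournais 2020, (2.32) in first quantisation**: `∫ ‖b_pΦ‖²_{L²(Λⁿ)} dp ≤ ‖χ‖²_∞ n ℓ⁻³ ⟨Φ, n₊Φ⟩`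
(Cauchy–Schwarz in `∑ᵢ`, Tonelli, Plancherel slice-wise). [cite: Fournais2020, (2.32)] -/
theorem lintegral_lintegral_normSq_bVec_le {χ : Space → ℝ} (hχ : Continuous χ) {Cχ : ℝ} (hCχ : ∀ x, ‖χ x‖ ≤ Cχ)
    {ℓ : ℝ} (hℓ : 0 < ℓ) (u : Space) {Φ : Config n → ℂ} (hΦ : Measurable Φ) :
    ∫⁻ p : Space, ∫⁻ X in boxConfig n ℓ u, ((‖bVec χ ℓ u p Φ X‖₊ : ℝ≥0∞)) ^ 2 ≤
      ENNReal.ofReal (Cχ ^ 2) * n * (ENNReal.ofReal ℓ ^ 3)⁻¹ * nPlusBoxN ℓ u Φ := by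
  set c : ℝ≥0∞ := (ENNReal.ofReal ℓ ^ 3)⁻¹ with hc
  have hG : ∀ i : Fin n, Measurable fun r : Space × Config n => ((‖excAmp χ ℓ u i Φ r.2 r.1‖₊ : ℝ≥0∞)) ^ 2 :=
    fun i => (((measurable_excAmp hχ ℓ u i hΦ).comp measurable_swap).nnnorm.coe_nnreal_ennreal).pow_const _
  set C : ℝ≥0∞ := ENNReal.ofReal (((ℓ ^ 3)⁻¹) ^ 2 * n) with hC
  have hCc : C = n * c * c := by
    rw [hC, hc, ENNReal.ofReal_mul (by positivity), ENNReal.ofReal_natCast, sq,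
      ENNReal.ofReal_mul (by positivity), ENNReal.ofReal_inv_of_pos (by positivity), ENNReal.ofReal_pow hℓ.le]
    ring
  have hFm : Measurable fun r : Space × Config n =>
      C * ∑ i : Fin n, ((‖excAmp χ ℓ u i Φ r.2 r.1‖₊ : ℝ≥0∞)) ^ 2 :=
    Measurable.const_mul (Finset.measurable_sum _ fun i _ => hG i) _
  have hGX : ∀ (X : Config n) (i : Fin n), Measurable fun p : Space => ((‖excAmp χ ℓ u i Φ X p‖₊ : ℝ≥0∞)) ^ 2 :=
    fun X i => (((measurable_excAmp hχ ℓ u i hΦ).comp (measurable_prodMk_left (x := X))).nnnorm.coe_nnreal_ennreal).pow_const 2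
  have hmX : ∀ i : Fin n, Measurable fun X : Config n => ∫⁻ p : Space, ((‖excAmp χ ℓ u i Φ X p‖₊ : ℝ≥0∞)) ^ 2 :=
    fun i => (hG i).lintegral_prod_left'
  -- Step 1: pointwise Cauchy–Schwarz
  have h1 : ∫⁻ p : Space, ∫⁻ X in boxConfig n ℓ u, ((‖bVec χ ℓ u p Φ X‖₊ : ℝ≥0∞)) ^ 2 ≤
      ∫⁻ p : Space, ∫⁻ X in boxConfig n ℓ u, C * ∑ i : Fin n, ((‖excAmp χ ℓ u i Φ X p‖₊ : ℝ≥0∞)) ^ 2 :=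
    lintegral_mono fun p => lintegral_mono fun X => nnnorm_bVec_sq_le χ ℓ u p Φ X
  -- Step 2: Tonelli
  have h2 : ∫⁻ p : Space, ∫⁻ X in boxConfig n ℓ u, C * ∑ i : Fin n, ((‖excAmp χ ℓ u i Φ X p‖₊ : ℝ≥0∞)) ^ 2 =
      ∫⁻ X in boxConfig n ℓ u, ∫⁻ p : Space, C * ∑ i : Fin n, ((‖excAmp χ ℓ u i Φ X p‖₊ : ℝ≥0∞)) ^ 2 :=
    lintegral_lintegral_swap hFm.aemeasurable
  -- Step 3: linearity and Plancherel slice-wise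
  have h3 : ∀ X : Config n, ∫⁻ p : Space, C * ∑ i : Fin n, ((‖excAmp χ ℓ u i Φ X p‖₊ : ℝ≥0∞)) ^ 2 ≤
      C * ENNReal.ofReal (Cχ ^ 2) *
        ∑ i : Fin n, ∫⁻ y, ((‖projQ ℓ u (fun z => Φ (Function.update X i z)) y‖₊ : ℝ≥0∞)) ^ 2 := by
    intro X
    rw [lintegral_const_mul' _ _ ENNReal.ofReal_ne_top, lintegral_finsetSum _ fun i _ => hGX X i, mul_assoc,
      Finset.mul_sum, Finset.mul_sum, Finset.mul_sum]
    exact Finset.sum_le_sum fun i _ => mul_le_mul_right (lintegral_normSq_excAmp_le hχ hCχ ℓ u i hΦ X) C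
  have hmQ : ∀ i : Fin n, Measurable fun X : Config n =>
      ∫⁻ y, ((‖projQ ℓ u (fun z => Φ (Function.update X i z)) y‖₊ : ℝ≥0∞)) ^ 2 := fun i =>
    ((measurable_projQ_slice ℓ u i hΦ).nnnorm.coe_nnreal_ennreal.pow_const _).lintegral_prod_right'
  have h4 : ∫⁻ X in boxConfig n ℓ u, C * ENNReal.ofReal (Cχ ^ 2) *
        ∑ i : Fin n, ∫⁻ y, ((‖projQ ℓ u (fun z => Φ (Function.update X i z)) y‖₊ : ℝ≥0∞)) ^ 2 =
      C * ENNReal.ofReal (Cχ ^ 2) * ∑ i : Fin n, ∫⁻ X in boxConfig n ℓ u,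
        ∫⁻ y, ((‖projQ ℓ u (fun z => Φ (Function.update X i z)) y‖₊ : ℝ≥0∞)) ^ 2 := by
    rw [lintegral_const_mul' _ _ (ENNReal.mul_ne_top ENNReal.ofReal_ne_top ENNReal.ofReal_ne_top),
      lintegral_finsetSum _ fun i _ => hmQ i]
  -- Step 4: identify `nPlusBoxN`
  have h5 : C * ENNReal.ofReal (Cχ ^ 2) * ∑ i : Fin n, ∫⁻ X in boxConfig n ℓ u,
        ∫⁻ y, ((‖projQ ℓ u (fun z => Φ (Function.update X i z)) y‖₊ : ℝ≥0∞)) ^ 2 =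
      ENNReal.ofReal (Cχ ^ 2) * n * c * nPlusBoxN ℓ u Φ := by
    rw [hCc, nPlusBoxN, Finset.mul_sum, Finset.mul_sum]
    refine Finset.sum_congr rfl fun i _ => ?_
    rw [← hc]
    ring
  calc ∫⁻ p : Space, ∫⁻ X in boxConfig n ℓ u, ((‖bVec χ ℓ u p Φ X‖₊ : ℝ≥0∞)) ^ 2
      ≤ ∫⁻ X in boxConfig n ℓ u, ∫⁻ p : Space, C * ∑ i : Fin n, ((‖excAmp χ ℓ u i Φ X p‖₊ : ℝ≥0∞)) ^ 2 :=
        h1.trans_eq h2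
    _ ≤ ∫⁻ X in boxConfig n ℓ u, C * ENNReal.ofReal (Cχ ^ 2) *
          ∑ i : Fin n, ∫⁻ y, ((‖projQ ℓ u (fun z => Φ (Function.update X i z)) y‖₊ : ℝ≥0∞)) ^ 2 :=
        lintegral_mono h3
    _ = _ := by rw [h4, h5]

end Literature.MathematicalPhysics.QuantumManyBody.BoseGas

end
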